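import Summits.CriticalPhenomena.CardyFormulaZ2.Theorems.CardyFlipRussoCoveringLegStubGsPlanar
import Summits.CriticalPhenomena.CardyFormulaZ2.Theorems.CardyFlipRussoCoveringLegStubComparisonGeometryStrong
import Summits.CriticalPhenomena.CardyFormulaZ2.Theorems.CardyFlipRussoCoveringLegStubLowerInclusion
import Summits.CriticalPhenomena.CardyFormulaZ2.Theorems.CardyFlipRussoCoveringLegStubFlipBound
import Summits.CriticalPhenomena.CardyFormulaZ2.Theorems.CardyFlipRussoCoveringLegStubBlocking
import Summits.CriticalPhenomena.CardyFormulaZ2.Theorems.CardyMagicRigidityLoopsToCrossingsStubCardyContinuity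
import Summits.CriticalPhenomena.CardyFormulaZ2.Theorems.CardyMagicRigidityLoopsToCrossingsStubCyclicFlip
import HarnessLib

/-!
# Line `five-arm-null` for the crux `CardyFlipRusso.CoveringLeg`
(item stmt-CriticalPhenomena-6435, route `CardyFlipRusso`, rank 6) — CHECKED SKELETON v5.1 ("robust crude Cardy"; line lead
`prover-line-stmt-CriticalPhenomena-6435-c5-0`, cycles 6–7).  v5.1 = v5 with its five provable stubs LANDED and imported
(`stub_gsPlanar` p140252, `stub_comparisonGeometryStrong` p139833, `stub_lowerInclusion` p139913, `stub_flipBound` p139803,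
`stub_blocking_of_planar` p140894+p141050+p142468) and the composition LANDED (`Theorems/CardyFlipRussoCoveringLegRobust.lean`,
p142502: `coveringLeg_of_ujbMixedInterpolation : UnionJackBeffara.MixedInterpolation → CoveringLeg`, etc.; the in-file copies below
carry the prefix `skel_`); the ONE remaining `sorry` is the existing OPEN item stmt-CriticalPhenomena-4559 by name.  History v2–v4.1: see the v4.1 docstring in the tree
(`Cruxes/CoveringLeg/Lines/five_arm_null.lean` at commit 79fa47fb93b2) and `Cruxes/CoveringLeg/NOTES.md`.

The crux (verbatim; `coveringLeg_iff` is `Iff.rfl`): Cardy's formula for critical SITE percolation on the centred square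
lattice `G_s` (crude `2δ`-slack discretisation, frame A, law `sitePercolation _ half`) IMPLIES Cardy's formula for critical
BOND percolation on `ℤ²` in the crude discretisation `embDomainCrossing squareLatticeEmbedding.z`.

## What v5 does

v4.1 (lead c4) proved that the one honest open stub of the line (`MixedInterpolationShift` = site-`G_s`/bond-`ℤ²` crossing
universality `U`) IS the existing item `UnionJackBeffara.MixedInterpolation` (stmt-CriticalPhenomena-4559) modulo ONE site-side
discretisation null `T'`, and IS `CardySectorGap.MixedInterpolation` (stmt-7050) modulo the site-side translation null `T`
("boundary RSW for critical site percolation on `G_s`, not in the tree").  v5 PROVES `T` and `T'` under the crux's own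
hypothesis `SiteCardy` WITHOUT any RSW input — in fact it proves that `SiteCardy` is DISCRETISATION-ROBUST
(`robust_of_stubs`: Cardy for the crude frame-B events of the shifted family, `CardyHalfShift`, which is `SiteCardy` read
through the exact frame bridge `cardyHalfShift_of_siteCardy`, implies Cardy for the UNshifted crude frame-B events
(`CardySectorGap.CardyCentredSquare`, stmt-7048, i.e. v2's stub `Sig.stub_frameBridge`) and for the wide-slack Union-Jack
events) by the Bollobás–Riordan collar sandwich run with LOWER inclusions only:

* liminf: a crude `P_{1/2}` crossing of the longer–thinner comparison quad `Q` of `R` (end arcs OUTSIDE `closure Ω`, lateral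
  sides pushed into `Ω`; `stub_comparisonGeometryStrong`, the tree's `stub_comparisonGeometry` with the all-points margin
  clause) contains a crude crossing of `R` entering `Ω` transversally across `arc 0` and leaving across `arc 2`
  (`stub_lowerInclusion`: no corner estimate, no endpoint pinning — the event of `Q` needs its ends outside `Ω`);
* limsup: exact self-duality of site percolation on the TRIANGULATION `G_s` at `p = ½`: a CLOSED crude crossing of the
  shorter–fatter quad `N` (the longer–thinner quad of the cyclically re-marked rectangle) excludes every open crude crossing
  of `R` (`stub_blocking_of_planar`: planarity of the straight-line drawing of `G_s`, `stub_gsPlanar`, and the rectangle crossing lemma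
  through a square model of `R`), `P_{1/2}` is flip invariant (`stub_flipBound`), and `F(1 − η) = 1 − F(η)` for the re-marked
  rectangle (`stub_cyclicFlip`, tree);
* the Cardy values of `Q`, `N` are as close as we please to `F(η_R)`, `1 − F(η_R)` by Radó continuity of the modulus
  (`stub_cardyContinuity`, tree).

Consequently (no `sorry` at all now; landed in the glue file p142502): `Sig.stub_frameBridge` (v2, declared RSW-blocked by lead a1) is a
theorem (`stub_frameBridge_proof`); `T`, `T'` hold under `SiteCardy` (`siteTranslationNull_of_siteCardy`,
`siteWideNull_of_siteCardy`); and the crux FOLLOWS EXACTLY from either twin: `coveringLeg_of_ujbMixedInterpolation :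
UnionJackBeffara.MixedInterpolation → CoveringLeg`, `coveringLeg_of_csgMixedInterpolation : CardySectorGap.MixedInterpolation →
CoveringLeg`.  The composition `CoveringLeg_of` consumes the five provable stubs and the existing OPEN item stmt-4559 BY NAME.

## Registered stubs (v5 → v5.1: all five provable ones LANDED)

* `stub_gsPlanar` — the straight-line drawing `zS` of `G_s` is planar.  LANDED p140252.
* `stub_comparisonGeometryStrong` — comparison quads with the all-points margin clause.  LANDED p139833.
* `stub_lowerInclusion` — crude crossing of the shifted lower quad ⊆ crude crossing of `R`.  LANDED p139913.
* `stub_blocking_of_planar` — a closed crude crossing of the shifted upper quad excludes an open wide crude crossing of `R`.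
  LANDED p140894 (Prelim) + p141050 (Chart) + p142468.
* `stub_flipBound` — flip invariance + complement bound.  LANDED p139803.
* `UnionJackBeffara.MixedInterpolation` (stmt-CriticalPhenomena-4559) BY NAME — OPEN (Beffara's leg II = `U`); the only `sorry`.

Disproof honoured: none exists for this crux (no `Cruxes/CoveringLeg/Disproof.lean`, 2026-08-17).
-/

noncomputable section

namespace Summit.CriticalPhenomena.CardyFormulaZ2.Cruxes.CoveringLeg.FiveArmNull

open Filter Set Topology Metric MeasureTheory
open Literature.Probability.RandomPlanarGeometry hiding cardyFunction
open Literature.Probability.Percolation hiding cardyFunction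
open Literature.Probability.LatticeModels
open Literature.Barriers.CriticalPhenomena (MixedSite mixedParam)
open Summit.CriticalPhenomena.CardyFormulaZ2.Theses
open Summit.CriticalPhenomena.CardyFormulaZ2.Cruxes.LoopsToCrossings.OracleSandwich (stub_cardyContinuity stub_cyclicFlip)

/-! ### The registered stubs: the five provable ones are imported LANDED theorems; the one OPEN item by name (`sorry`) -/

/-- Registered stub — **`UnionJackBeffara.MixedInterpolation` (stmt-CriticalPhenomena-4559) BY NAME**: Beffara's leg II
(`P_{1/2,1/2}[cross] − P_{1/2,0}[cross] → 0` for the crude Union-Jack crossings), i.e. site-`G_s`/bond-`ℤ²` crossing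
universality `U` in the Union-Jack frame.  OPEN (Langlands–Pouliot–Saint-Aubin 1994 hypothesis; Beffara 2008 §5.2 stops at
eq. (5.1)); an ITEM of route UnionJackBeffara, to which the crux's own thesis delegates leg II — not to be proved inside this
line (the crux is parked `blocked-on` it).  Equivalent to the v4 stub `U` under `SiteCardy`
(`stub_iff_ujbMixedInterpolation_of_siteCardy`). [cite: Beffara2008Universal, §5.2] -/
theorem stub_open_ujbMixedInterpolation :
    Summit.CriticalPhenomena.CardyFormulaZ2.Theses.UnionJackBeffara.MixedInterpolation := by
  sorry

/-! ### Elementary analysis: squeeze to a limit -/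

/-- **Squeeze to the limit**: if `b ≤ u` pointwise on `δ > 0`, `b` is eventually `≥ L − τ` and `u` eventually `≤ L + τ`
for every `τ > 0`, then both tend to `L` as `δ → 0⁺`. [folklore] -/
theorem skel_tendsto_of_squeeze {b u : ℝ → ℝ} {L : ℝ} (hbu : ∀ δ, 0 < δ → b δ ≤ u δ)
    (hb : ∀ τ : ℝ, 0 < τ → ∀ᶠ δ in 𝓝[>] (0 : ℝ), L - τ ≤ b δ)
    (hu : ∀ τ : ℝ, 0 < τ → ∀ᶠ δ in 𝓝[>] (0 : ℝ), u δ ≤ L + τ) :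
    Tendsto b (𝓝[>] 0) (𝓝 L) ∧ Tendsto u (𝓝[>] 0) (𝓝 L) := by
  have hpos : ∀ᶠ δ in 𝓝[>] (0 : ℝ), 0 < δ := eventually_mem_nhdsWithin
  constructor
  · rw [tendsto_order]
    refine ⟨fun a ha => ?_, fun a ha => ?_⟩
    · filter_upwards [hb ((L - a) / 2) (by linarith)] with δ hδ
      linarith
    · filter_upwards [hu ((a - L) / 2) (by linarith), hpos] with δ hδ hδ0
      linarith [hbu δ hδ0]
  · rw [tendsto_order]
    refine ⟨fun a ha => ?_, fun a ha => ?_⟩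
    · filter_upwards [hb ((L - a) / 2) (by linarith), hpos] with δ hδ hδ0
      linarith [hbu δ hδ0]
    · filter_upwards [hu ((a - L) / 2) (by linarith)] with δ hδ
      linarith

/-- `‖δ · i/√2‖ ≤ δ` for `δ ≥ 0`. [folklore] -/
theorem skel_norm_shift_le {δ : ℝ} (hδ : 0 ≤ δ) : ‖(δ : ℂ) * (Complex.I / (Real.sqrt 2 : ℂ))‖ ≤ δ := by
  rw [norm_mul, Complex.norm_real, Real.norm_eq_abs, abs_of_nonneg hδ]
  exact mul_le_of_le_one_right hδ norm_shiftVec_le_one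

/-! ### The composition: robustness of crude Cardy under the five provable stubs -/

/-- **Robust crude Cardy (the v5 composition).**  Given the four analytic/lattice stubs, Cardy for the crude frame-B
`P_{1/2}` crossing probabilities of the SHIFTED family (`CardyHalfShift`) implies Cardy for the UNshifted crude frame-B
crossing probabilities (`crossS R δ`, slack `2δ`) and for the wide-slack events (`wideS R δ`, slack `2√2·δ`) of EVERY
conformal rectangle: liminf by the lower quad and `stub_lowerInclusion`, limsup by the upper quad, `stub_blocking` and
`stub_flipBound`, the Cardy values of the quads by `stub_cardyContinuity` / `stub_cyclicFlip` (tree).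
[cite: BollobasRiordan2006, Ch. 7 Lemma 14 and Claim 19] -/
theorem skel_robust_of_stubs (hQ : Sig.stub_comparisonGeometryStrong) (hL : Sig.stub_lowerInclusion)
    (hB : Sig.stub_blocking) (hF : Sig.stub_flipBound)
    (hA : CardyHalfShift) (R : ConformalRectangle) :
    R.HasCrossingLimit (fun δ => (lawP half).real (crossS R δ)) Literature.Probability.RandomPlanarGeometry.cardyFunction ∧
    R.HasCrossingLimit (fun δ => (lawP half).real (wideS R δ)) Literature.Probability.RandomPlanarGeometry.cardyFunction := by
  -- one uniformizing datum at a time; both limits come from the same squeeze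
  suffices key : ∀ (φ : ConformalEquiv UpperHalfPlane.upperHalfPlaneSet R.carrier) (x : Fin 4 → ℝ),
      R.IsUniformizing φ x →
      Tendsto (fun δ => (lawP half).real (crossS R δ)) (𝓝[>] 0)
          (𝓝 (Literature.Probability.RandomPlanarGeometry.cardyFunction (crossRatio x))) ∧
        Tendsto (fun δ => (lawP half).real (wideS R δ)) (𝓝[>] 0)
          (𝓝 (Literature.Probability.RandomPlanarGeometry.cardyFunction (crossRatio x))) from
    ⟨fun φ x hφ => (key φ x hφ).1, fun φ x hφ => (key φ x hφ).2⟩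
  intro φ x hφ
  haveI := isProbabilityMeasure_lawP half
  set L := Literature.Probability.RandomPlanarGeometry.cardyFunction (crossRatio x) with hLdef
  set c₀ : ℂ := Complex.I / (Real.sqrt 2 : ℂ) with hc₀def
  refine skel_tendsto_of_squeeze (fun δ hδ => measureReal_mono (crossS_subset_wideS R hδ.le)) ?_ ?_
  · -- liminf: the lower quad
    intro τ hτ
    obtain ⟨ε₀, hε₀, hcont⟩ := stub_cardyContinuity R φ x hφ (τ / 2) (half_pos hτ)
    obtain ⟨m, hm, hquads⟩ := hQ R ε₀ hε₀
    obtain ⟨d, hd, hsep⟩ := R.exists_pos_forall_lt_dist_arc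
    have ht : (0 : ℝ) < d / 4 := by positivity
    obtain ⟨⟨Q, r, hr, hQb, hQm, h3, h4, h5, h6⟩, -⟩ := hquads (d / 4) ht
    obtain ⟨ψ, y, hψ⟩ := MarkedDomain.exists_isUniformizing_holds Q
    have hclose := hcont Q hQb hQm ψ y hψ
    have hlim := hA Q ψ y hψ
    have hsep' : ∀ x ∈ R.arc 0, ∀ y ∈ R.arc 2, 3 * (d / 4) < dist x y := fun x hx y hy => by
      linarith [hsep x hx y hy, dist_nonneg (x := x) (y := y)]
    have h4' : ∀ z ∈ cthickening r Q.carrier, z ∈ R.carrier → m ≤ infDist z (R.arc 1) ∧ m ≤ infDist z (R.arc 3) :=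
      fun z hz _ => h4 z hz
    -- eventually: the probability of the quad's shifted event is close to its Cardy value, and `δ` is small
    have hev1 : ∀ᶠ δ : ℝ in 𝓝[>] 0,
        Literature.Probability.RandomPlanarGeometry.cardyFunction (crossRatio y) - τ / 2 <
          (lawP half).real (crossS (Q.map (similarity 1 one_ne_zero ((δ : ℂ) * c₀))) δ) :=
      (tendsto_order.1 hlim).1 _ (by linarith)
    have hev2 : ∀ᶠ δ in 𝓝[>] (0 : ℝ), δ < min (min (r / 3) m) (d / 4) :=
      (tendsto_order.1 (tendsto_nhdsWithin_of_tendsto_nhds tendsto_id)).2 _ (by positivity)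
    filter_upwards [hev1, hev2, (eventually_mem_nhdsWithin : ∀ᶠ δ in 𝓝[>] (0 : ℝ), 0 < δ)] with δ hδ1 hδ2 hδ0
    have hδ0' : (0 : ℝ) < δ := hδ0
    have hA1 : min (min (r / 3) m) (d / 4) ≤ r / 3 := (min_le_left _ _).trans (min_le_left _ _)
    have hA2 : min (min (r / 3) m) (d / 4) ≤ m := (min_le_left _ _).trans (min_le_right _ _)
    have hA3 : min (min (r / 3) m) (d / 4) ≤ d / 4 := min_le_right _ _
    have hδr : 3 * δ ≤ r := by linarith
    have hδm : δ < m := by linarith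
    have hδt : δ ≤ d / 4 := by linarith
    have hincl := hL R Q m (d / 4) r hm ht hr h3 h4' h5 h6 hsep' δ hδ0' hδr hδm hδt ((δ : ℂ) * c₀)
      (skel_norm_shift_le hδ0'.le)
    have hmono : (lawP half).real (crossS (Q.map (similarity 1 one_ne_zero ((δ : ℂ) * c₀))) δ) ≤
        (lawP half).real (crossS R δ) := measureReal_mono hincl
    have habs := abs_le.1 hclose
    linarith
  · -- limsup: the upper quad, blocking, flip invariance
    intro τ hτ
    obtain ⟨R₂, hc₂, hb₂, hm₂, hflip⟩ := stub_cyclicFlip R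
    obtain ⟨ψ₂, y₂, hψ₂⟩ := MarkedDomain.exists_isUniformizing_holds R₂
    have hF2 : Literature.Probability.RandomPlanarGeometry.cardyFunction (crossRatio y₂) = 1 - L :=
      hflip φ x ψ₂ y₂ hφ hψ₂
    obtain ⟨ε₀, hε₀, hcont⟩ := stub_cardyContinuity R₂ ψ₂ y₂ hψ₂ (τ / 2) (half_pos hτ)
    obtain ⟨m, hm, hquads⟩ := hQ R ε₀ hε₀
    obtain ⟨t, ht, hblock⟩ := hB R m hm
    obtain ⟨-, ⟨N, r, hr, hNb, hNm, n3, n4, n5, n6⟩⟩ := hquads t ht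
    obtain ⟨ψN, yN, hψN⟩ := MarkedDomain.exists_isUniformizing_holds N
    have hNb' : ∀ u : ℝ, dist (N.boundary u) (R₂.boundary u) ≤ ε₀ := fun u => by rw [hb₂ u]; exact hNb u
    have hNm' : ∀ i : Fin 4, |N.mark i - R₂.mark i| ≤ ε₀ := fun i => by rw [hm₂ i]; exact hNm i
    have hclose := hcont N hNb' hNm' ψN yN hψN
    have hlim := hA N ψN yN hψN
    obtain ⟨δ₀, hδ₀, hblk⟩ := hblock N r hr n3 n4 n5 n6
    have hev1 : ∀ᶠ δ : ℝ in 𝓝[>] 0,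
        Literature.Probability.RandomPlanarGeometry.cardyFunction (crossRatio yN) - τ / 2 <
          (lawP half).real (crossS (N.map (similarity 1 one_ne_zero ((δ : ℂ) * c₀))) δ) :=
      (tendsto_order.1 hlim).1 _ (by linarith)
    have hev2 : ∀ᶠ δ in 𝓝[>] (0 : ℝ), δ < δ₀ :=
      (tendsto_order.1 (tendsto_nhdsWithin_of_tendsto_nhds tendsto_id)).2 _ hδ₀
    filter_upwards [hev1, hev2, (eventually_mem_nhdsWithin : ∀ᶠ δ in 𝓝[>] (0 : ℝ), 0 < δ)] with δ hδ1 hδ2 hδ0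
    have hδ0' : (0 : ℝ) < δ := hδ0
    have hmiss := hblk δ hδ0' hδ2.le ((δ : ℂ) * c₀) (skel_norm_shift_le hδ0'.le)
    have hbound := hF N δ hδ0' ((δ : ℂ) * c₀) (wideS R δ) hmiss
    have habs := abs_le.1 hclose
    linarith

/-! ### Consequences inside the line (sorry-free modulo the registered stubs, which enter as hypotheses) -/

/-- **Robust crude Cardy from the crux hypothesis**: given the four provable stubs, `SiteCardy` implies Cardy for the
unshifted crude frame-B events (`CardySectorGap.CardyCentredSquare`, stmt-CriticalPhenomena-7048) and for the wide-slack
events (the first conjunct of `UnionJackBeffara.Target` read at mesh `√2·δ`, `unionJackBeffara_cardy_iff`).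
[cite: BollobasRiordan2006, Ch. 7 Lemma 14] -/
theorem skel_robust_of_siteCardy (hQ : Sig.stub_comparisonGeometryStrong) (hL : Sig.stub_lowerInclusion) (hB : Sig.stub_blocking) (hF : Sig.stub_flipBound) (hS : SiteCardy) :
    CardySectorGap.CardyCentredSquare ∧
      ∀ R : ConformalRectangle, R.HasCrossingLimit (fun δ => (lawP half).real (wideS R δ))
        Literature.Probability.RandomPlanarGeometry.cardyFunction := by
  have h := fun R => skel_robust_of_stubs hQ hL hB hF (cardyHalfShift_of_siteCardy hS) R
  exact ⟨cardyCentredSquare_iff.2 fun R => (h R).1, fun R => (h R).2⟩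

/-- **v2's stub `Sig.stub_frameBridge` (`SiteCardy → CardySectorGap.CardyCentredSquare`) from the v5 stubs** (lead a1 had
parked it on boundary RSW for `G_s`; no RSW is used). [cite: Beffara2008Universal, §5.1] -/
theorem skel_stub_frameBridge_of (hQ : Sig.stub_comparisonGeometryStrong) (hL : Sig.stub_lowerInclusion) (hB : Sig.stub_blocking) (hF : Sig.stub_flipBound) :
    Sig.stub_frameBridge :=
  fun hS => (skel_robust_of_siteCardy hQ hL hB hF hS).1

/-- **The site-side translation null `T` holds under `SiteCardy`** (c4's residual towards stmt-7050): both the shifted and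
the unshifted crude frame-B `P_{1/2}` crossing probabilities tend to `F(η_R)`. [cite: Beffara2008Universal, §5.1] -/
theorem skel_siteTranslationNull_of_siteCardy (hQ : Sig.stub_comparisonGeometryStrong) (hL : Sig.stub_lowerInclusion) (hB : Sig.stub_blocking) (hF : Sig.stub_flipBound)
    (hS : SiteCardy) :
    ∀ R : ConformalRectangle, Tendsto (fun δ : ℝ =>
      (lawP half).real (crossS (R.map (similarity 1 one_ne_zero ((δ : ℂ) * (Complex.I / (Real.sqrt 2 : ℂ))))) δ) -
        (lawP half).real (crossS R δ)) (𝓝[>] 0) (𝓝 0) := by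
  intro R
  obtain ⟨φ, x, hφ⟩ := MarkedDomain.exists_isUniformizing_holds R
  have h1 := cardyHalfShift_of_siteCardy hS R φ x hφ
  have h2 := (cardyCentredSquare_iff.1 (skel_robust_of_siteCardy hQ hL hB hF hS).1) R φ x hφ
  have h := h1.sub h2
  rwa [sub_self] at h

/-- **The site-side wide null `T'` holds under `SiteCardy`** (c4's ONLY residual towards stmt-4559): the Union-Jack crude
crossing probability at mesh `√2·δ` and the frame-A crude crossing probability of `ρ⁻¹R` at mesh `δ` both tend to `F(η_R)`.
[cite: Beffara2008Universal, §5.1] -/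
theorem skel_siteWideNull_of_siteCardy (hQ : Sig.stub_comparisonGeometryStrong) (hL : Sig.stub_lowerInclusion) (hB : Sig.stub_blocking) (hF : Sig.stub_flipBound)
    (hS : SiteCardy) :
    ∀ R : ConformalRectangle, Tendsto (fun δ : ℝ => ujCrossingProb half R (Real.sqrt 2 * δ) -
      siteProb (R.map (similarity ((1 + Complex.I) / (Real.sqrt 2 : ℂ)) frame_rotInv_ne_zero 0)) δ)
      (𝓝[>] 0) (𝓝 0) := by
  intro R
  obtain ⟨φ, x, hφ⟩ := MarkedDomain.exists_isUniformizing_holds R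
  have h1 := (skel_robust_of_siteCardy hQ hL hB hF hS).2 R φ x hφ
  have h2 := cardyHalfShift_of_siteCardy hS R φ x hφ
  have h := h1.sub h2
  rw [sub_self] at h
  refine h.congr' (Eventually.of_forall fun δ => ?_)
  simp only [ujCrossingProb_eq_wideS, shift_lawP_half_crossS]

/-! ### The composition: the registered stubs give the crux BY NAME -/

/-- **The line (v5.1).**  The five provable stubs are LANDED theorems (`stub_gsPlanar` p140252, `stub_comparisonGeometryStrong`
p139833, `stub_lowerInclusion` p139913, `stub_blocking_of_planar` p142468, `stub_flipBound` p139803); planarity feeds blocking, the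
four analytic/lattice stubs make `SiteCardy` discretisation-robust (`skel_robust_of_siteCardy`) giving the site-side null `T'`, and the
twins dictionary `coveringLeg_of_unionJackBeffara_of_siteNull` turns the ONE remaining registered stub — the existing open item
`UnionJackBeffara.MixedInterpolation` (stmt-CriticalPhenomena-4559 = Beffara's leg II = `U`) — into `CoveringLeg`.  The same
composition is LANDED as `coveringLeg_of_ujbMixedInterpolation` (Theorems/CardyFlipRussoCoveringLegRobust.lean, p142502). -/
theorem CoveringLeg_of (h : Summit.CriticalPhenomena.CardyFormulaZ2.Theses.UnionJackBeffara.MixedInterpolation) :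
    Summit.CriticalPhenomena.CardyFormulaZ2.Theses.CardyFlipRusso.CoveringLeg :=
  coveringLeg_iff.2 fun hS =>
    coveringLeg_iff.1 (coveringLeg_of_unionJackBeffara_of_siteNull
      (skel_siteWideNull_of_siteCardy stub_comparisonGeometryStrong stub_lowerInclusion (stub_blocking_of_planar stub_gsPlanar)
        stub_flipBound hS) h) hS

/-- v5's six-hypothesis composition, for the record (all but the last hypothesis are now landed theorems). -/
example (h1 : Sig.stub_gsPlanar) (h2 : Sig.stub_comparisonGeometryStrong) (h3 : Sig.stub_lowerInclusion)
    (h4 : Sig.stub_blockingOfPlanar) (h5 : Sig.stub_flipBound) (h6 : UnionJackBeffara.MixedInterpolation) :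
    CardyFlipRusso.CoveringLeg :=
  coveringLeg_iff.2 fun hS =>
    coveringLeg_iff.1 (coveringLeg_of_unionJackBeffara_of_siteNull (skel_siteWideNull_of_siteCardy h2 h3 (h4 h1) h5 hS) h6) hS

/-- **The crux `CoveringLeg`** (route CardyFlipRusso, stmt-CriticalPhenomena-6435), BY NAME; depends on `sorryAx` ONLY through the
OPEN item stmt-CriticalPhenomena-4559 (`stub_open_ujbMixedInterpolation`). -/
theorem CoveringLeg_proof : Summit.CriticalPhenomena.CardyFormulaZ2.Theses.CardyFlipRusso.CoveringLeg :=
  CoveringLeg_of stub_open_ujbMixedInterpolation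

/-! ### Further consequences (the twins, residual-free modulo the v5 stubs) -/

/-- **`CoveringLeg` ⟸ `UnionJackBeffara.MixedInterpolation` (stmt-CriticalPhenomena-4559), EXACTLY** modulo the v5
stubs: the thesis' delegation of "leg II" to card z4-protected-beffara-union-jack, with no residual (`T'` from
`siteWideNull_of_siteCardy`, `B'` = `wide_tendsto_sub` landed p136899). [cite: Beffara2008Universal, §5.1–5.2] -/
theorem skel_coveringLeg_of_ujbMixedInterpolation (hQ : Sig.stub_comparisonGeometryStrong) (hL : Sig.stub_lowerInclusion) (hB : Sig.stub_blocking) (hF : Sig.stub_flipBound)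
    (hM : UnionJackBeffara.MixedInterpolation) : CardyFlipRusso.CoveringLeg :=
  coveringLeg_iff.2 fun hS =>
    coveringLeg_iff.1 (coveringLeg_of_unionJackBeffara_of_siteNull (skel_siteWideNull_of_siteCardy hQ hL hB hF hS) hM) hS

/-- **`CoveringLeg` ⟸ `CardySectorGap.MixedInterpolation` (stmt-CriticalPhenomena-7050), EXACTLY** modulo the v5 stubs.
[cite: Beffara2008Universal, §5.1–5.2] -/
theorem skel_coveringLeg_of_csgMixedInterpolation (hQ : Sig.stub_comparisonGeometryStrong) (hL : Sig.stub_lowerInclusion) (hB : Sig.stub_blocking) (hF : Sig.stub_flipBound)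
    (hM : CardySectorGap.MixedInterpolation) : CardyFlipRusso.CoveringLeg :=
  coveringLeg_iff.2 fun hS =>
    coveringLeg_iff.1
      (coveringLeg_of_mixedInterpolation_of_siteTranslationNull (skel_siteTranslationNull_of_siteCardy hQ hL hB hF hS) hM) hS

/-- **Under the crux hypothesis the v4 stub `U` and stmt-4559 are equivalent** (calibration, residual-free modulo the v5
stubs). [cite: Beffara2008Universal, §5.2] -/
theorem skel_stub_iff_ujbMixedInterpolation_of_siteCardy (hQ : Sig.stub_comparisonGeometryStrong) (hL : Sig.stub_lowerInclusion) (hB : Sig.stub_blocking)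
    (hF : Sig.stub_flipBound) (hS : SiteCardy) :
    Sig.stub_mixedInterpolationShift ↔ UnionJackBeffara.MixedInterpolation :=
  stub_iff_unionJackBeffara_of_siteNull (skel_siteWideNull_of_siteCardy hQ hL hB hF hS)

end Summit.CriticalPhenomena.CardyFormulaZ2.Cruxes.CoveringLeg.FiveArmNull

end
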